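import Literature.NumberTheory.EllipticCurves.Kato2004.EulerSystemTatePairingValuesTwo
import HarnessLib

/-!
# Kato 2004 Thm. 12.5 (1) read on the layer Tate pairing at `p = 2` — the fact
# `exists_eulerSystem_expStar_tatePairing_values_two` FOLLOWS from its «value-datum pairing law» form
# (Kato's Euler system with ONE value datum `Λ` + Rubin 1998 §5 (1)–(2) / Kobayashi 2003 (8.29) for `Λ` on EVERY class,
# up to one non-zero RATIONAL normalisation constant)

`Proofs`-style companion of `EulerSystemTatePairingValuesTwo.lean` (THEOREMS ONLY: no definition, no named fact, no
instance, no notation, no `sorry`).  Seat `bsd-input-kato-es-two` g0 (literature-prover, cell `pub/bsd-wall/bsd-inputs`,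
«inputs → unconditional», `--supports stmt-BirchSwinnertonDyer-22680`, helper).  HONEST FRAMING: nothing here proves the
fact `F := exists_eulerSystem_expStar_tatePairing_values_two` (Kato's zeta elements with his explicit reciprocity law at
`p = 2` — a published input, size XL); the file lands the honest REDUCTION of `F` to the shape in which print proves it and
isolates what a `_holds` must supply; no `_holds`, no item closed; no summit statement (`BirchSwinnertonDyer`) is proved or
advanced by this file.

## What is proved

* §1 (tools, the Literature home of a Summits-side helper lemma of cell `bsd-addord`, vendored verbatim as
  `CyclotomicLayerTatePairing.lean` vendored the layer pairing; the character-sum lemma `charSum_rat_smul` — Kato's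
  character sum is `ℚ`-linear in the value — is a private copy): `zetaBody_rat_smul` — the matrix
  `ZetaBody W p f ι κ Λ c d a A z x` of `EulerSystemValues.lean` is HOMOGENEOUS under `(κ, Λ, x) ↦ (u κ, u Λ, u x)` for every `u ∈ ℚ` (classes `z` untouched):
  (C1)/(C2) do not mention `(κ, Λ, x)`, (C3a)/(C3b)/(C4) are `ℚ_p`-linear, (C5) is `ℚ`-linear in `x` on the left and in
  `κ` on the right [Kato Thm. 9.7 p. 189, Thm. 6.6 (1) p. 163: both sides of the value law are linear].
* §2 `exists_eulerSystem_expStar_tatePairing_values_two_of_pairingLaw_upTo` — **`F♯˟ → F`**, where `F♯˟` has the SAME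
  binders as `F` (place `v ∣ 2`, `W` globally minimal with `GoodSS W 2`, cyclotomic `κ`, newform `f`, the continuous
  `2`-adic frame `(Φ, φ)`, a coherent tower `e` with lifts `τ`, the standard complex frame `ιC`) and asserts: ONE real
  `κK ≠ 0`, ONE value datum `ΛK` and ONE rational `u ≠ 0` such that
  (C6˟) for EVERY layer `n`, EVERY class `y ∈ H¹(ℚ(μ_{2^{n+2}}), T₂W)` and every formal layer point `Q₀`, the
  `T₂W`-adic layer Tate pairing `t = ⟨Cor y, Q₀⟩_n ∈ ℤ₂` (displayed through its residues `CyclotomicLayer.tatePairingPk`)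
  satisfies `t = u · Σ_{b ∈ (ℤ/2^{n+2})ˣ} τ_{n+2}(b) (log_{W⊗ℚ₂}(z(Q₀)) · ẽ_{n+2}(ΛK y))`, `ẽ_{n+2} : ℚ₂ ⊗_ℚ ℚ(ζ_{2^{n+2}}) → ℚ̄₂`
  the extension of `e_{n+2}` (`Algebra.TensorProduct.lift`), AND Kato's matrix: for all admissible `(c, d, a, A)` there
  are `z, x` with `ZetaBody W 2 f ιC κK ΛK c d a A z x`.  PROOF: rescale the witnesses by `u` (§1), instantiate (C6˟) at
  `y := z_{n+2,∅}` and rewrite `ẽ(ΛK z) = e(x)` by (C4) `ΛK z = 1 ⊗ x` (`lift_tmul`); the rational `u` is fixed by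
  `Gal(ℚ̄₂/ℚ₂)` and comes out of the sum.  `exists_eulerSystem_expStar_tatePairing_values_two_of_pairingLaw` is the case
  `u = 1` (`F♯ → F`).

## Why this is the print shape, and what remains (the «needs X» of the seat, recorded — NOT asserted here)

Print proves `F` as `F♯˟` with `ΛK := exp*_{ω_W} ∘ loc₂` (the Bloch–Kato dual exponential of `V₂W` over the level fields
in the coordinate of the Néron differential of the minimal model): Kato Thm. 12.5 (1) / Thm. 9.7 / Thm. 6.6 (1) / Prop. 8.12
/ Ex. 13.3 give the Euler system and its RATIONAL `exp*`-values with the `L`-value law [Kato2004Asterisque pp. 221–222,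
189, 163, 186, 225] — in the `ω_E`-normalisation this is Rubin 1998 Thm. 7.1 [Rubin1998Durham] (`r_E ∈ ℤ_{>0}`: the
`f̄`- and `ω`-coordinates differ by a RATIONAL constant, absorbed by `u`); and (C6˟) for THIS `ΛK` on every class is
Rubin 1998 §5 displays (1)–(2) «`z` corresponds to `x ↦ Tr_{ℚ_{n,p}/ℚ_p} λ_E(x) exp*_{ω_E}(z)`» = Kobayashi 2003 (8.29)
«`(x, z)_n = Tr_{k_n/ℚ_p} log_Ê(x) exp*_{ω_E}(z)`» [p. 24] = Kato LNM 1553 II Thm. 1.4.1 (4) with Lemma 1.4.3–1.4.5 and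
Bloch–Kato 1990 Ex. 3.10.1 / (3.11.1) [pp. 359–361], composed with the projection formula `⟨Cor y, Q⟩_{k_n} = ⟨y, Q⟩_{M_n}`
and `Tr_{M_n/ℚ₂} = Σ_b τ_b` on `M_n = ℚ₂(μ_{2^{n+2}})` (sign / cup-order / trace conventions are uniform rational units,
absorbed by `u`).  In the TREE: the Kato half is the named fact `exists_eulerSystem_definedExpStar_values`
(`EulerSystemDefinedValues.lean`, `exp*` DEFINED via `bdRPeriodRingData.dualExpCoord`) up to (i) its EXISTENTIAL complex
frame `ι` versus the STANDARD frame `ιC` pinned here (Kato (5.7.1) p. 157 prints the standard frame) and (ii) its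
hypothesis `W.HasIrreducibleModPGaloisRep 2`, a theorem under `GoodSS W 2` (Serre 1972 Prop. 12; Summits-side
`Rank1Residual.P2.irr_two_of_goodSS_two`); the local half (C6˟) for the DEFINED `exp*` is NOT in the tree as a statement
(its consequence «range of `exp*_ω` = trace-dual of `log_ω E(F)`» is the named fact
`PAdicHodge.exists_smul_range_expStarCoord_iff_trace_log`).  The seat's evidence note on stmt-BirchSwinnertonDyer-22680
types both as `def … : Prop` sketches with locators.  Nothing of this paragraph is used below.

## References

* K. Kato, Astérisque 295 (2004): Thm. 12.5 (1) pp. 221–222, Thm. 9.7 p. 189, Thm. 6.6 (1) p. 163, Prop. 8.12 p. 186,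
  (8.1.3) p. 180, Ex. 13.3 p. 225, (5.7.1) p. 157. [Kato2004Asterisque]
* K. Rubin, *Euler systems and modular elliptic curves*, LMS LN 254 (1998), §5 (1)–(2), Thm. 7.1, Cor. 7.2. [Rubin1998Durham]
* S. Kobayashi, Invent. math. 152 (2003), (8.23) p. 18, (8.28)–(8.29) and Prop. 8.25 p. 24. [Kobayashi2003]
* S. Bloch, K. Kato (1990), Prop. 3.8 p. 354, Def. 3.10, Ex. 3.10.1 pp. 359–360, Ex. 3.11 p. 361. [BlochKato1990]
* K. Kato, LNM 1553 (1993), Ch. II Thm. 1.4.1 (4), Lemma 1.4.3–1.4.5. [Kato1993LNM1553]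
* Tree: `Kato2004/EulerSystemTatePairingValuesTwo.lean` (the fact), `Kato2004/EulerSystemValues.lean` (`ZetaBody`,
  `charSum`), `Kato2004/EulerSystemDefinedValues.lean`, `PAdicHodge/DualExpElliptic.lean`; Summits-side originals of §1:
  `Summits/BirchSwinnertonDyer/BirchSwinnertonDyer/Theorems/KimAtThreeDeepLowerZetaBodyRatScaling.lean`
  (`charSum_rat_smul`, `map_id_smul`, `zetaBody_rat_smul`), and of the §2 pattern:
  `…/Theorems/ThetaPartnerAtTwoSignedKatoUpToAtTwoKatoBKCoreKZOfKBKStd.lean` (`KatoBK.coreKZ_of_coreKBKStd`).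
-/

noncomputable section

open scoped Classical NumberField TensorProduct
open Field IsDedekindDomain CongruenceSubgroup NumberField WeierstrassCurve
open Literature.NumberTheory.GaloisRepresentations
open Literature.NumberTheory.EllipticCurves Literature.NumberTheory.EllipticCurves.ModularForms
open Literature.NumberTheory.EllipticCurves.Rank1Residual Literature.NumberTheory.EllipticCurves.Kobayashi2003
open Literature.NumberTheory.EllipticCurves.Kato2004.EulerSystemValues
open ZpExtension

namespace Literature.NumberTheory.EllipticCurves.Kato2004

/-! ## §1 Tools: `charSum` and `ZetaBody` are homogeneous under a rational scalar -/

section Scaling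

/-- **Kato's character sum is `ℚ`-linear in the value**: `Σ_b χ(b) ι(σ_b (u·y)) = u · Σ_b χ(b) ι(σ_b y)` for `u ∈ ℚ`
(private copy of the Summits-side tool lemma of the same name, cell `bsd-addord`). [folklore] -/
private theorem EulerSystemValues.charSum_rat_smul (n : ℕ) [NeZero n] (ι₀ : CyclotomicField n ℚ →+* ℂ)
    (χ : DirichletCharacter ℂ n) (u : ℚ) (y : CyclotomicField n ℚ) :
    charSum n ι₀ χ (u • y) = (u : ℂ) * charSum n ι₀ χ y := by
  unfold charSum
  rw [Finset.mul_sum]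
  refine Finset.sum_congr rfl fun b _ => ?_
  rw [Algebra.smul_def, map_mul, AlgEquiv.commutes, map_mul, eq_ratCast, map_ratCast]
  ring

/-- The left `ℚ_p`-action on `ℚ_p ⊗_ℚ K` commutes with `id ⊗ σ`. [folklore] -/
private theorem map_id_smul {p : ℕ} [Fact p.Prime] {K : Type*} [CommRing K] [Algebra ℚ K] (σ : K →ₐ[ℚ] K)
    (s : ℚ_[p]) (t : ℚ_[p] ⊗[ℚ] K) :
    Algebra.TensorProduct.map (AlgHom.id ℚ ℚ_[p]) σ (s • t) =
      s • Algebra.TensorProduct.map (AlgHom.id ℚ ℚ_[p]) σ t := by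
  have hsmul : ∀ w : ℚ_[p] ⊗[ℚ] K, s • w = (s ⊗ₜ[ℚ] (1 : K)) * w := fun w => by
    rw [Algebra.smul_def]; rfl
  rw [hsmul, hsmul, map_mul, Algebra.TensorProduct.map_tmul, AlgHom.id_apply, map_one]

variable {W : WeierstrassCurve ℚ} [W.IsElliptic] {p : ℕ} [Fact p.Prime]
  [ContinuousSMul ℤ_[p] (W.tateModule p)] [Module.Free ℤ_[p] (W.tateModule p)]
  [Module.Finite ℤ_[p] (W.tateModule p)] {N : ℕ} {f : CuspForm (Gamma0 N) 2}
  {ι : (m : ℕ) → (CyclotomicField m ℚ →+* ℂ)} {κ : ℝ}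
  {Λ : ∀ (k : ℕ) (r : Finset (HeightOneSpectrum (𝓞 ℚ))),
    H1 (tateRep W p) (cycSubgroup p k r) →ₗ[ℤ_[p]] ℚ_[p] ⊗[ℚ] CyclotomicField (cycLevel p k r) ℚ}
  {c d a : ℤ} {A : ℕ}
  {z : ∀ (k : ℕ) (r : (cyclotomicLevelsRat p (badPlaces c d A N)).Ideals),
    H1 (tateRep W p) ((cyclotomicLevelsRat p (badPlaces c d A N)).level k r.1)}
  {x : ∀ (k : ℕ) (r : (cyclotomicLevelsRat p (badPlaces c d A N)).Ideals),
    CyclotomicField (cycLevel p k r.1) ℚ}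

set_option backward.isDefEq.respectTransparency false in
/-- **`ZetaBody` is homogeneous in `(κ, Λ, x)` under a rational scalar `u`** (classes `z` untouched): (C1)/(C2) do not
mention them, (C3a)/(C3b)/(C4) are `ℚ_p`-linear, (C5) is linear in `x` on the left (`charSum_rat_smul`) and in `κ` on
the right.  The Literature home of the Summits-side tool lemma of cell `bsd-addord` (same proof); Kato prints his
values coordinate-free, so a uniform rational change of the `exp*`-coordinate is invisible to the matrix.
[cite: Kato2004Asterisque, Thm. 9.7 (p. 189) and Thm. 6.6 (1) (p. 163)] -/
theorem zetaBody_rat_smul (u : ℚ) (hbody : ZetaBody W p f ι κ Λ c d a A z x) :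
    ZetaBody W p f ι ((u : ℝ) * κ) (fun k r => (u : ℚ_[p]) • Λ k r) c d a A z (fun k r => u • x k r) := by
  obtain ⟨h1, h2, h3a, h3b, h4, h5⟩ := hbody
  refine ⟨h1, h2, ?_, ?_, ?_, ?_⟩
  · intro k r σ y
    rw [LinearMap.smul_apply, LinearMap.smul_apply, h3a k r σ y, map_id_smul]
  · intro k r y hy
    rw [LinearMap.smul_apply, h3b k r y hy, smul_zero]
  · intro k r
    rw [LinearMap.smul_apply, h4 k r, TensorProduct.tmul_smul, ← algebraMap_smul ℚ_[p] u,
      Algebra.algebraMap_eq_smul_one, Rat.smul_one_eq_cast]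
  · intro k r d' χ Lχ hcd hdd' hL
    obtain ⟨heven, hodd⟩ := h5 k r d' χ Lχ hcd hdd' hL
    refine ⟨fun hχ => ?_, fun hχ => ?_⟩
    · rw [charSum_rat_smul, heven hχ]
      push_cast
      ring
    · rw [charSum_rat_smul, hodd hχ]
      push_cast
      ring

end Scaling

/-! ## §2 `F♯˟ → F`: the fact follows from its value-datum pairing-law form, up to a rational unit -/

section PairingLaw

/-- A Galois automorphism of `ℚ̄₂/ℚ₂` fixes a rational scalar in front of an element of `ℚ̄₂`. [folklore] -/
private theorem gal_smul_ratCast_mul (g : Field.absoluteGaloisGroup ℚ_[2]) (u : ℚ) (w : PadicAlgCl 2) :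
    g • ((u : PadicAlgCl 2) * w) = (u : PadicAlgCl 2) * g • w := by
  rw [smul_mul', ← MulSemiringAction.toRingHom_apply _ _ g (u : PadicAlgCl 2), map_ratCast]

set_option backward.isDefEq.respectTransparency false in
/-- **`F♯˟ → F` (Kato 2004 Thm. 12.5 (1) read on the layer Tate pairing at `2`, from its value-datum pairing-law form up to a
rational unit).**  Suppose that for every datum `(v, W, κ, f, Φ, φ, e, τ, ιC)` as in the fact there are ONE real `κK ≠ 0`, ONE
value datum `ΛK` and ONE rational `u ≠ 0` such that (C6˟) for every layer `n`, every class `y ∈ H¹(ℚ(μ_{2^{n+2}}), T₂W)` and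
every formal layer point `Q₀` the `T₂W`-adic layer Tate pairing value `t = ⟨Cor y, Q₀⟩_n` satisfies
`t = u · Σ_{b ∈ (ℤ/2^{n+2})ˣ} τ_{n+2}(b) (log_{W⊗ℚ₂}(z(Q₀)) · ẽ_{n+2}(ΛK y))` [Rubin 1998 §5 (1)–(2); Kobayashi 2003 (8.29);
Bloch–Kato 1990 Ex. 3.10.1 / 3.11; Kato LNM 1553 II Thm. 1.4.1 (4)], and Kato's matrix `ZetaBody W 2 f ιC κK ΛK c d a A z x`
has witnesses for all admissible `(c, d, a, A)` [Kato 2004 (8.1.3), Prop. 8.12, Thm. 9.7, Thm. 6.6 (1), Ex. 13.3, Thm. 12.5 (1)].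
THEN `exists_eulerSystem_expStar_tatePairing_values_two` holds: rescale `(κK, ΛK, x) ↦ (u κK, u ΛK, u x)`
(`zetaBody_rat_smul`), instantiate (C6˟) at `y := z_{n+2,∅}` and use (C4) `ΛK z = 1 ⊗ x`.  A reduction; `F` itself is NOT
proved here. [cite: Kato2004Asterisque, Thm. 12.5 (1) (pp. 221–222), Thm. 9.7 (p. 189), Thm. 6.6 (1) (p. 163)]
[cite: Rubin1998Durham, §5 displays (1)–(2) and Thm. 7.1] [cite: Kobayashi2003, (8.23) (p. 18), (8.28)–(8.29) and Prop. 8.25 (p. 24)]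
[cite: BlochKato1990, Def. 3.10 and Ex. 3.10.1 (pp. 359–360), Ex. 3.11 (p. 361)] -/
theorem exists_eulerSystem_expStar_tatePairing_values_two_of_pairingLaw_upTo
    (h : ∀ (v : HeightOneSpectrum (𝓞 ℚ)), ((2 : ℕ) : 𝓞 ℚ) ∈ v.asIdeal →
      ∀ (W : WeierstrassCurve ℚ) [W.IsElliptic] [W.IsGloballyMinimal], GoodSS W 2 →
      ∀ (κ : ZpExtension ℚ 2) (hκ : κ.IsCyclotomic),
      ∀ [NeZero (W.conductorNorm ℤ)] (f : CuspForm (Gamma0 (W.conductorNorm ℤ)) 2), IsNewformOf W f →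
      ∀ [ContinuousSMul ℤ_[2] (W.tateModule 2)] [Module.Free ℤ_[2] (W.tateModule 2)]
        [Module.Finite ℤ_[2] (W.tateModule 2)],
      ∀ (Φ : AlgebraicClosure ℚ_[2] ≃ₐ[ℚ] AlgebraicClosure (v.adicCompletion ℚ)) (φ : ℚ_[2] ≃+* v.adicCompletion ℚ),
        (∀ y : ℚ_[2], Φ (algebraMap ℚ_[2] (AlgebraicClosure ℚ_[2]) y) =
          algebraMap (v.adicCompletion ℚ) (AlgebraicClosure (v.adicCompletion ℚ)) (φ y)) →
      ∀ (e : ∀ k : ℕ, CyclotomicField (cycLevel 2 k ∅) ℚ →ₐ[ℚ] PadicAlgCl 2)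
        (τ : ∀ m : ℕ, ZMod (2 ^ m) → Field.absoluteGaloisGroup ℚ_[2]),
        (∀ k : ℕ, e (k + 1) (IsCyclotomicExtension.zeta (cycLevel 2 (k + 1) ∅) ℚ (CyclotomicField (cycLevel 2 (k + 1) ∅) ℚ)) ^ 2 =
          e k (IsCyclotomicExtension.zeta (cycLevel 2 k ∅) ℚ (CyclotomicField (cycLevel 2 k ∅) ℚ))) →
        (∀ (k : ℕ) (a : ZMod (2 ^ k)), IsUnit a →
          τ k a • e k (IsCyclotomicExtension.zeta (cycLevel 2 k ∅) ℚ (CyclotomicField (cycLevel 2 k ∅) ℚ)) =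
            e k (IsCyclotomicExtension.zeta (cycLevel 2 k ∅) ℚ (CyclotomicField (cycLevel 2 k ∅) ℚ)) ^ a.val) →
      ∀ (ιC : (m : ℕ) → (CyclotomicField m ℚ →+* ℂ)),
      (∀ k : ℕ, ιC (cycLevel 2 k ∅) (IsCyclotomicExtension.zeta (cycLevel 2 k ∅) ℚ (CyclotomicField (cycLevel 2 k ∅) ℚ)) =
        Complex.exp (2 * Real.pi * Complex.I / (cycLevel 2 k ∅ : ℕ))) →
      ∃ κK : ℝ, κK ≠ 0 ∧
      ∃ ΛK : ∀ (k : ℕ) (r : Finset (HeightOneSpectrum (𝓞 ℚ))),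
          H1 (tateRep W 2) (cycSubgroup 2 k r) →ₗ[ℤ_[2]] ℚ_[2] ⊗[ℚ] CyclotomicField (cycLevel 2 k r) ℚ,
      ∃ u : ℚ, u ≠ 0 ∧
        -- (C6˟): the value datum is read on the layer Tate pairing against formal points, up to the rational unit `u`
        (∀ (n : ℕ) (y : H1 (tateRep W 2) (cycSubgroup 2 (n + 2) ∅)) (Q₀ : localPoints W ℚ_[2])
            (hQv : WeierstrassCurve.Affine.Point.map (W' := W)
                (Φ : AlgebraicClosure ℚ_[2] →ₐ[ℚ] AlgebraicClosure (v.adicCompletion ℚ))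
                (show (W.baseChange (AlgebraicClosure ℚ_[2])).toAffine.Point from Q₀) ∈
              localLayerPointsOfEmb κ (closureEmb (K := ℚ) (v.adicCompletion ℚ)) W n),
            (∀ (X Y : AlgebraicClosure ℚ_[2]) (hXY : (W.baseChange (AlgebraicClosure ℚ_[2])).toAffine.Nonsingular X Y),
                (show (W.baseChange (AlgebraicClosure ℚ_[2])).toAffine.Point from Q₀) = .some X Y hXY → 1 < Valued.v X) →
            ∃ t : ℤ_[2],
              (∀ k : ℕ, CyclotomicLayer.tatePairingPk W κ v n k
                  (levelToLayerTwo W hκ (∅ : Set (HeightOneSpectrum (𝓞 ℚ))) n y) ⟨_, hQv⟩ = PadicInt.toZModPow k t) ∧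
              algebraMap ℚ_[2] (PadicAlgCl 2) (t : ℚ_[2]) =
                (u : PadicAlgCl 2) *
                  ∑ b : (ZMod (2 ^ (n + 2)))ˣ, τ (n + 2) (b : ZMod (2 ^ (n + 2))) •
                    ((∑' i : ℕ, algebraMap ℚ_[2] (PadicAlgCl 2) (PowerSeries.coeff i (W.map (algebraMap ℚ ℚ_[2])).formalLog) *
                        (WeierstrassCurve.Affine.Point.zCoord
                          (show (W.baseChange (AlgebraicClosure ℚ_[2])).toAffine.Point from Q₀)) ^ i) *
                      Algebra.TensorProduct.lift (algebraMap ℚ_[2] (PadicAlgCl 2)).toRatAlgHom (e (n + 2))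
                        (fun _ _ ↦ Commute.all _ _) (ΛK (n + 2) ∅ y))) ∧
        -- Kato's matrix (C1)–(C5) for the SAME value datum
        ∀ (c d a : ℤ) (A : ℕ), 0 < A → Int.gcd c (6 * 2 * A) = 1 → Int.gcd d (6 * 2 * W.conductorNorm ℤ) = 1 →
          ∃ (z : ∀ (k : ℕ) (r : (cyclotomicLevelsRat 2 (badPlaces c d A (W.conductorNorm ℤ))).Ideals),
                H1 (tateRep W 2) ((cyclotomicLevelsRat 2 (badPlaces c d A (W.conductorNorm ℤ))).level k r.1))
            (x : ∀ (k : ℕ) (r : (cyclotomicLevelsRat 2 (badPlaces c d A (W.conductorNorm ℤ))).Ideals),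
                CyclotomicField (cycLevel 2 k r.1) ℚ),
            ZetaBody W 2 f ιC κK ΛK c d a A z x) :
    exists_eulerSystem_expStar_tatePairing_values_two := by
  intro v hv W _ _ hss κ hκ _ f hf _ _ _ Φ φ hΦφ e τ he hτ ιC hιC
  obtain ⟨κK, hκK, ΛK, u, hu, hC6, hKato⟩ := h v hv W hss κ hκ f hf Φ φ hΦφ e τ he hτ ιC hιC
  refine ⟨(u : ℝ) * κK, mul_ne_zero (Rat.cast_ne_zero.mpr hu) hκK, fun k r => (u : ℚ_[2]) • ΛK k r,
    fun c d a A hA hc hd => ?_⟩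
  obtain ⟨z, x, hbody⟩ := hKato c d a A hA hc hd
  refine ⟨z, fun k r => u • x k r, zetaBody_rat_smul u hbody, fun n Q₀ hQv hformal => ?_⟩
  obtain ⟨t, ht, htval⟩ :=
    hC6 n (z (n + 2) (cyclotomicLevelsRat 2 (badPlaces c d A (W.conductorNorm ℤ))).idealOne) Q₀ hQv hformal
  refine ⟨t, ht, ?_⟩
  -- (C4): `ΛK z_{n+2,∅} = 1 ⊗ x_{n+2,∅}`, so `ẽ(ΛK z) = e(x)`
  have hC4 := hbody.2.2.2.2.1 (n + 2) (cyclotomicLevelsRat 2 (badPlaces c d A (W.conductorNorm ℤ))).idealOne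
  obtain ⟨xF, hxF⟩ : ∃ xF : CyclotomicField (cycLevel 2 (n + 2) (∅ : Finset (HeightOneSpectrum (𝓞 ℚ)))) ℚ,
      xF = x (n + 2) (cyclotomicLevelsRat 2 (badPlaces c d A (W.conductorNorm ℤ))).idealOne := ⟨_, rfl⟩
  have hlift : Algebra.TensorProduct.lift (algebraMap ℚ_[2] (PadicAlgCl 2)).toRatAlgHom (e (n + 2))
      (fun _ _ ↦ Commute.all _ _) (ΛK (n + 2) ∅
        (z (n + 2) (cyclotomicLevelsRat 2 (badPlaces c d A (W.conductorNorm ℤ))).idealOne)) = e (n + 2) xF := by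
    have h4 : ΛK (n + 2) ∅ (z (n + 2) (cyclotomicLevelsRat 2 (badPlaces c d A (W.conductorNorm ℤ))).idealOne) =
        (1 : ℚ_[2]) ⊗ₜ[ℚ] xF := by rw [hxF]; exact hC4
    rw [h4, Algebra.TensorProduct.lift_tmul, map_one, one_mul]
  -- the rescaled value: `e(u • x) = u · e(x)`, and `u` is fixed by every `τ_{n+2}(b)`
  have hex' : e (n + 2) (u • xF) = (u : PadicAlgCl 2) * e (n + 2) xF := by
    rw [Algebra.smul_def, map_mul, AlgHom.commutes, eq_ratCast]
  have hex : e (n + 2) ((fun k r => u • x k r) (n + 2)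
      (cyclotomicLevelsRat 2 (badPlaces c d A (W.conductorNorm ℤ))).idealOne) = (u : PadicAlgCl 2) * e (n + 2) xF := by
    rw [← hex', hxF]
  rw [htval, hlift, hex, Finset.mul_sum]
  refine Finset.sum_congr rfl fun b _ => ?_
  rw [← mul_assoc, mul_comm _ (u : PadicAlgCl 2), mul_assoc, gal_smul_ratCast_mul]

set_option backward.isDefEq.respectTransparency false in
/-- **`F♯ → F`** (the case `u = 1` of `exists_eulerSystem_expStar_tatePairing_values_two_of_pairingLaw_upTo`): if for
every datum as in the fact there are `κK ≠ 0` and ONE value datum `ΛK` satisfying (C6) «`⟨Cor y, Q₀⟩_n =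
Σ_b τ_{n+2}(b) (log_{W⊗ℚ₂}(z(Q₀)) · ẽ_{n+2}(ΛK y))` for every class `y` and formal layer point `Q₀`» [Rubin 1998 §5 (1)–(2);
Kobayashi 2003 (8.29)] together with Kato's matrix for all admissible `(c, d, a, A)` [Kato 2004 Thm. 12.5 (1) etc.], then
`exists_eulerSystem_expStar_tatePairing_values_two` holds.  A reduction; `F` itself is NOT proved here.
[cite: Kato2004Asterisque, Thm. 12.5 (1) (pp. 221–222), Thm. 9.7 (p. 189)] [cite: Rubin1998Durham, §5 displays (1)–(2)]
[cite: Kobayashi2003, (8.28)–(8.29) and Prop. 8.25 (p. 24)] -/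
theorem exists_eulerSystem_expStar_tatePairing_values_two_of_pairingLaw
    (h : ∀ (v : HeightOneSpectrum (𝓞 ℚ)), ((2 : ℕ) : 𝓞 ℚ) ∈ v.asIdeal →
      ∀ (W : WeierstrassCurve ℚ) [W.IsElliptic] [W.IsGloballyMinimal], GoodSS W 2 →
      ∀ (κ : ZpExtension ℚ 2) (hκ : κ.IsCyclotomic),
      ∀ [NeZero (W.conductorNorm ℤ)] (f : CuspForm (Gamma0 (W.conductorNorm ℤ)) 2), IsNewformOf W f →
      ∀ [ContinuousSMul ℤ_[2] (W.tateModule 2)] [Module.Free ℤ_[2] (W.tateModule 2)]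
        [Module.Finite ℤ_[2] (W.tateModule 2)],
      ∀ (Φ : AlgebraicClosure ℚ_[2] ≃ₐ[ℚ] AlgebraicClosure (v.adicCompletion ℚ)) (φ : ℚ_[2] ≃+* v.adicCompletion ℚ),
        (∀ y : ℚ_[2], Φ (algebraMap ℚ_[2] (AlgebraicClosure ℚ_[2]) y) =
          algebraMap (v.adicCompletion ℚ) (AlgebraicClosure (v.adicCompletion ℚ)) (φ y)) →
      ∀ (e : ∀ k : ℕ, CyclotomicField (cycLevel 2 k ∅) ℚ →ₐ[ℚ] PadicAlgCl 2)
        (τ : ∀ m : ℕ, ZMod (2 ^ m) → Field.absoluteGaloisGroup ℚ_[2]),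
        (∀ k : ℕ, e (k + 1) (IsCyclotomicExtension.zeta (cycLevel 2 (k + 1) ∅) ℚ (CyclotomicField (cycLevel 2 (k + 1) ∅) ℚ)) ^ 2 =
          e k (IsCyclotomicExtension.zeta (cycLevel 2 k ∅) ℚ (CyclotomicField (cycLevel 2 k ∅) ℚ))) →
        (∀ (k : ℕ) (a : ZMod (2 ^ k)), IsUnit a →
          τ k a • e k (IsCyclotomicExtension.zeta (cycLevel 2 k ∅) ℚ (CyclotomicField (cycLevel 2 k ∅) ℚ)) =
            e k (IsCyclotomicExtension.zeta (cycLevel 2 k ∅) ℚ (CyclotomicField (cycLevel 2 k ∅) ℚ)) ^ a.val) →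
      ∀ (ιC : (m : ℕ) → (CyclotomicField m ℚ →+* ℂ)),
      (∀ k : ℕ, ιC (cycLevel 2 k ∅) (IsCyclotomicExtension.zeta (cycLevel 2 k ∅) ℚ (CyclotomicField (cycLevel 2 k ∅) ℚ)) =
        Complex.exp (2 * Real.pi * Complex.I / (cycLevel 2 k ∅ : ℕ))) →
      ∃ κK : ℝ, κK ≠ 0 ∧
      ∃ ΛK : ∀ (k : ℕ) (r : Finset (HeightOneSpectrum (𝓞 ℚ))),
          H1 (tateRep W 2) (cycSubgroup 2 k r) →ₗ[ℤ_[2]] ℚ_[2] ⊗[ℚ] CyclotomicField (cycLevel 2 k r) ℚ,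
        -- (C6): the value datum is read on the layer Tate pairing against formal points
        (∀ (n : ℕ) (y : H1 (tateRep W 2) (cycSubgroup 2 (n + 2) ∅)) (Q₀ : localPoints W ℚ_[2])
            (hQv : WeierstrassCurve.Affine.Point.map (W' := W)
                (Φ : AlgebraicClosure ℚ_[2] →ₐ[ℚ] AlgebraicClosure (v.adicCompletion ℚ))
                (show (W.baseChange (AlgebraicClosure ℚ_[2])).toAffine.Point from Q₀) ∈
              localLayerPointsOfEmb κ (closureEmb (K := ℚ) (v.adicCompletion ℚ)) W n),
            (∀ (X Y : AlgebraicClosure ℚ_[2]) (hXY : (W.baseChange (AlgebraicClosure ℚ_[2])).toAffine.Nonsingular X Y),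
                (show (W.baseChange (AlgebraicClosure ℚ_[2])).toAffine.Point from Q₀) = .some X Y hXY → 1 < Valued.v X) →
            ∃ t : ℤ_[2],
              (∀ k : ℕ, CyclotomicLayer.tatePairingPk W κ v n k
                  (levelToLayerTwo W hκ (∅ : Set (HeightOneSpectrum (𝓞 ℚ))) n y) ⟨_, hQv⟩ = PadicInt.toZModPow k t) ∧
              algebraMap ℚ_[2] (PadicAlgCl 2) (t : ℚ_[2]) =
                ∑ b : (ZMod (2 ^ (n + 2)))ˣ, τ (n + 2) (b : ZMod (2 ^ (n + 2))) •
                  ((∑' i : ℕ, algebraMap ℚ_[2] (PadicAlgCl 2) (PowerSeries.coeff i (W.map (algebraMap ℚ ℚ_[2])).formalLog) *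
                      (WeierstrassCurve.Affine.Point.zCoord
                        (show (W.baseChange (AlgebraicClosure ℚ_[2])).toAffine.Point from Q₀)) ^ i) *
                    Algebra.TensorProduct.lift (algebraMap ℚ_[2] (PadicAlgCl 2)).toRatAlgHom (e (n + 2))
                      (fun _ _ ↦ Commute.all _ _) (ΛK (n + 2) ∅ y))) ∧
        -- Kato's matrix (C1)–(C5) for the SAME value datum
        ∀ (c d a : ℤ) (A : ℕ), 0 < A → Int.gcd c (6 * 2 * A) = 1 → Int.gcd d (6 * 2 * W.conductorNorm ℤ) = 1 →
          ∃ (z : ∀ (k : ℕ) (r : (cyclotomicLevelsRat 2 (badPlaces c d A (W.conductorNorm ℤ))).Ideals),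
                H1 (tateRep W 2) ((cyclotomicLevelsRat 2 (badPlaces c d A (W.conductorNorm ℤ))).level k r.1))
            (x : ∀ (k : ℕ) (r : (cyclotomicLevelsRat 2 (badPlaces c d A (W.conductorNorm ℤ))).Ideals),
                CyclotomicField (cycLevel 2 k r.1) ℚ),
            ZetaBody W 2 f ιC κK ΛK c d a A z x) :
    exists_eulerSystem_expStar_tatePairing_values_two := by
  intro v hv W _ _ hss κ hκ _ f hf _ _ _ Φ φ hΦφ e τ he hτ ιC hιC
  obtain ⟨κK, hκK, ΛK, hC6, hKato⟩ := h v hv W hss κ hκ f hf Φ φ hΦφ e τ he hτ ιC hιC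
  refine ⟨κK, hκK, ΛK, fun c d a A hA hc hd => ?_⟩
  obtain ⟨z, x, hbody⟩ := hKato c d a A hA hc hd
  refine ⟨z, x, hbody, fun n Q₀ hQv hformal => ?_⟩
  obtain ⟨t, ht, htval⟩ :=
    hC6 n (z (n + 2) (cyclotomicLevelsRat 2 (badPlaces c d A (W.conductorNorm ℤ))).idealOne) Q₀ hQv hformal
  refine ⟨t, ht, ?_⟩
  have hC4 := hbody.2.2.2.2.1 (n + 2) (cyclotomicLevelsRat 2 (badPlaces c d A (W.conductorNorm ℤ))).idealOne
  obtain ⟨xF, hxF⟩ : ∃ xF : CyclotomicField (cycLevel 2 (n + 2) (∅ : Finset (HeightOneSpectrum (𝓞 ℚ)))) ℚ,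
      xF = x (n + 2) (cyclotomicLevelsRat 2 (badPlaces c d A (W.conductorNorm ℤ))).idealOne := ⟨_, rfl⟩
  have hlift : Algebra.TensorProduct.lift (algebraMap ℚ_[2] (PadicAlgCl 2)).toRatAlgHom (e (n + 2))
      (fun _ _ ↦ Commute.all _ _) (ΛK (n + 2) ∅
        (z (n + 2) (cyclotomicLevelsRat 2 (badPlaces c d A (W.conductorNorm ℤ))).idealOne)) = e (n + 2) xF := by
    have h4 : ΛK (n + 2) ∅ (z (n + 2) (cyclotomicLevelsRat 2 (badPlaces c d A (W.conductorNorm ℤ))).idealOne) =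
        (1 : ℚ_[2]) ⊗ₜ[ℚ] xF := by rw [hxF]; exact hC4
    rw [h4, Algebra.TensorProduct.lift_tmul, map_one, one_mul]
  rw [htval, hlift, hxF]

end PairingLaw

end Literature.NumberTheory.EllipticCurves.Kato2004

end
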